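import Literature.NumberTheory.LFunctions.CriticalLineTwoThirdsTraceProofs
import HarnessLib

/-!
# RH-FREE — «nothing here bears on the truth of RH»: Alpöge–Furman 2026 (arXiv:2608.13637) eq. (2.8) — second-order decay `|φ̂(z)| ≪ e^{L|Im z|/2}/|z|²` of the typed test function, and of `Φ = (φ²)^` (§5.1 (5.3)) — PROVED

Topic `Literature/NumberTheory/LFunctions` (namespace `Literature.NumberTheory.LFunctions.AlpogeFurman2026`).
Cell `rh-columns/lit`, unit `rh-lit-frontier-1` (gen 7). Source: **[AF26]** L. Alpöge, R. Furman,
*More than two thirds of the zeros of the Riemann zeta function are simple and on the critical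
line*, arXiv:2608.13637v2 (19 Aug 2026), UNREFEREED preprint (D-0012); locators = printed equation
numbers / pages of v2. This file has NO definition, NO claim and NO `sorry`; it is a proof layer for
`CriticalLineTwoThirdsMatrix.lean` (the typed `φ = AlpogeFurman2026.phi`).

## What the source prints

* §2.2 eq. (2.8) (p. 4): by Paley–Wiener and `j = 0, 1, 2` integrations by parts,
  `|φ̂(z)| ≪_χ e^{(L/2)|Im z|} · min(L, |z|⁻¹, |z|⁻²)` for `z ∈ ℂ`, since `‖φ‖₁ ≤ L`, `‖φ′‖₁ ≪_χ 1`,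
  `‖φ″‖₁ ≪_χ 1` (the `(√ψ)^{(j)}(u/L) L^{−j}` contribution being `≪ L^{1−j}` on the bulk).
* §5.1 eq. (5.3) (p. 7): integrating by parts in (2.8),
  `max(|φ̂(r)|, |Φ(r)|) ≤ ϑ(r) := min(L, 2/|r|, C_χ/(w r²))`, `Φ := (φ²)^`, `C_χ := ‖(φ²)″‖₁ ≪_χ 1`.

## What is proved here

The `|z|⁻²` branch of (2.8) and of (5.3), for the CONCRETE `φ_T = phi ψ T` of the typed model
(`χ = Real.smoothTransition`, window read through `clampHalf`), with a constant depending on the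
window only:

* `exists_norm_hat_phi_le_inv_sq` — for a window `ψ` there is `C` with
  `‖φ̂_T(z)‖ ≤ C e^{(L/2)|Im z|}/‖z‖²` for all `T` with `L = log(T/2π) ≥ 1` and all `z ≠ 0`;
  `exists_norm_hat_phi_le_inv_sq'` — the same at `z = ξ + iy` with denominator `ξ² + y²`;
* `exists_norm_hat_phi_sq_le_inv_sq`, `exists_norm_hat_phi_sq_ofReal_le` — the same for
  `Φ_T = (φ_T²)^` (complex and real argument: `|Φ_T(x)| ≤ C/x²`).

The `min(L, ·)` and `|z|⁻¹` branches are already in the tree (`norm_hat_phi_le` of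
`CriticalLineTwoThirdsTraceProofs`, first-order decay by the translation trick, and the trivial
bound). Together they give the majorant `ϑ` of (5.3), which Propositions 4.3 (tail) and 5.2
(reduction to the double integral) of [AF26] consume.

## How (the printed integration by parts, made honest at the clamp)

* §1 a generic lemma: if `f` vanishes off `(a,b)`, `f, f₁` are continuous on `[a,b]`,
  `f₁(a) = f₁(b) = 0`, `f′ = f₁`, `f₁′ = f₂` on the OPEN interval and `f₂` is continuous on `[a,b]`,
  then `f̂(z) = −z⁻² ∫_a^b f₂ e^{−izu}` (`z ≠ 0`; FTC in the form
  `intervalIntegral.integral_eq_sub_of_hasDeriv_right`, which needs derivatives only in the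
  interior — this is what lets the clamp `clampHalf` and the corners of `√ψ` at `±½` be ignored), hence
  `‖f̂(z)‖ ≤ e^{R|Im z|} (∫_{−R}^{R}‖f₂‖)/‖z‖²` on `[−R, R]`.
* §2 flat `C²` ramps `r` (`r = 0` on `(−∞,0]`, `r = 1` on `[1,∞)`): `r′, r″` vanish off `[0,1]`,
  `r′(0) = 0`, sup bounds and `L¹` norms `I₁ = ∫|r′|`, `I₂ = ∫|r″|`.
* §3 the product `P(u) = r(L/2+u) r(L/2−u)`: `P′, P″` explicitly, and
  `∫_ℝ |P′| ≤ 2C₀I₁`, `∫_ℝ |P″| ≤ 2C₀I₂ + 2C₁I₁` UNIFORMLY in `L` (translation invariance of `∫_ℝ`).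
* §4 the core `Q(u) = q(clampHalf(u/L))` for `q ∈ C²[−½,½]` (`q₁ = derivWithin q`, `q₂ =
  derivWithin q₁` on `[−½,½]`; interior `HasDerivAt` through the inactive clamp; `|Q₁| ≤ B₁/L`,
  `|Q₂| ≤ B₂/L²`), and the generic theorem `exists_norm_hat_rampWindow_le`:
  `‖(P·Q)^(z)‖ ≤ C e^{(L/2)|Im z|}/‖z‖²` for `L ≥ 1`, with
  `C = B₀(2C₀I₂ + 2C₁I₁) + 4B₁C₀I₁ + C₀²B₂`.
* §5 instantiation: `φ_T` is `r = χ`, `q = √ψ` (definitionally), and `φ_T²` is `r = χ²`, `q = ψ`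
  (`(√ψ)² = ψ` on `[−½,½]` by positivity).

STATUS NOTE (no endorsement). Elementary Fourier analysis of a compactly supported `C²` bump;
unconditional; says nothing about [AF26]'s Theorem 5.7 / Theorem A or about RH.

## References
* [AlpogeFurman2026] as above, §2.2 eq. (2.8) (p. 4), §5.1 eq. (5.3) (p. 7).
-/

noncomputable section

open Complex Filter Set MeasureTheory intervalIntegral
open scoped Real Topology

namespace Literature.NumberTheory.LFunctions

namespace AlpogeFurman2026

/-! ## §1. Two integrations by parts: `f̂(z) = −z⁻² ∫ f″ e^{−izu}` -/

/-- Derivative of the Fourier character `u ↦ e^{−izu}` along the real line. [folklore] -/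
private theorem hasDerivAt_cexp_neg_I_mul (z : ℂ) (u : ℝ) :
    HasDerivAt (fun v : ℝ ↦ cexp (-(I * z * v))) (-(I * z) * cexp (-(I * z * u))) u := by
  have h1 : HasDerivAt (fun w : ℂ ↦ -(I * z * w)) (-(I * z)) (u : ℂ) := by
    have h := ((hasDerivAt_id (u : ℂ)).const_mul (I * z)).neg
    simp only [mul_one] at h
    exact h
  have h2 := h1.cexp
  have h3 := h2.comp_ofReal
  simpa [mul_comm] using h3

/-- One integration by parts against `e^{−izu}` on `[a, b]` with vanishing boundary values:
`∫_a^b f′ e^{−izu} = iz ∫_a^b f e^{−izu}` (FTC for `f e^{−izu}`, derivatives on the open interval,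
continuity on the closed one). [folklore] -/
private theorem integral_deriv_mul_cexp_eq {f f₁ : ℝ → ℂ} {a b : ℝ} (hab : a ≤ b)
    (hfc : ContinuousOn f (Icc a b)) (hf1c : ContinuousOn f₁ (Icc a b))
    (hfa : f a = 0) (hfb : f b = 0) (hd : ∀ u ∈ Ioo a b, HasDerivAt f (f₁ u) u) (z : ℂ) :
    ∫ u in a..b, f₁ u * cexp (-(I * z * u)) = I * z * ∫ u in a..b, f u * cexp (-(I * z * u)) := by
  have hec : Continuous fun u : ℝ ↦ cexp (-(I * z * u)) := by fun_prop
  have hFc : ContinuousOn (fun u : ℝ ↦ f u * cexp (-(I * z * u))) (uIcc a b) := by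
    rw [uIcc_of_le hab]; exact hfc.mul hec.continuousOn
  have hderiv : ∀ u ∈ Ioo (min a b) (max a b),
      HasDerivWithinAt (fun u : ℝ ↦ f u * cexp (-(I * z * u)))
        (f₁ u * cexp (-(I * z * u)) + f u * (-(I * z) * cexp (-(I * z * u)))) (Ioi u) u := by
    intro u hu
    rw [min_eq_left hab, max_eq_right hab] at hu
    exact ((hd u hu).mul (hasDerivAt_cexp_neg_I_mul z u)).hasDerivWithinAt
  have hi1 : IntervalIntegrable (fun u : ℝ ↦ f₁ u * cexp (-(I * z * u))) volume a b :=
    (hf1c.mul hec.continuousOn).intervalIntegrable_of_Icc hab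
  have hi2 : IntervalIntegrable (fun u : ℝ ↦ f u * (-(I * z) * cexp (-(I * z * u)))) volume a b :=
    (hfc.mul ((continuous_const.mul hec).continuousOn)).intervalIntegrable_of_Icc hab
  have hFTC := integral_eq_sub_of_hasDeriv_right hFc hderiv (hi1.add hi2)
  rw [hfa, hfb, zero_mul, zero_mul, sub_zero, integral_add hi1 hi2] at hFTC
  have e : (∫ u in a..b, f u * (-(I * z) * cexp (-(I * z * u)))) =
      -(I * z) * ∫ u in a..b, f u * cexp (-(I * z * u)) := by
    rw [← intervalIntegral.integral_const_mul]
    congr 1 with u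
    ring
  rw [e] at hFTC
  linear_combination hFTC

/-- **Two integrations by parts.** If `f` vanishes off `(a, b)`, `f, f′` are continuous on `[a, b]`
with `f′(a) = f′(b) = 0`, `f′ = f₁`, `f″ = f₂` on `(a, b)` and `f₂` is integrable on `[a, b]`, then for
`z ≠ 0`: `f̂(z) = −z⁻² ∫_a^b f₂(u) e^{−izu} du`. [folklore] -/
private theorem hat_eq_of_hasDerivAt_two {f f₁ f₂ : ℝ → ℂ} {a b : ℝ} (hab : a ≤ b)
    (hf0 : ∀ u, u ∉ Ioo a b → f u = 0)
    (hfc : ContinuousOn f (Icc a b)) (hf1c : ContinuousOn f₁ (Icc a b))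
    (hf1a : f₁ a = 0) (hf1b : f₁ b = 0)
    (hd1 : ∀ u ∈ Ioo a b, HasDerivAt f (f₁ u) u) (hd2 : ∀ u ∈ Ioo a b, HasDerivAt f₁ (f₂ u) u)
    (hf2c : ContinuousOn f₂ (Icc a b)) {z : ℂ} (hz : z ≠ 0) :
    hat f z = -(1 / z ^ 2) * ∫ u in a..b, f₂ u * cexp (-(I * z * u)) := by
  have hfa : f a = 0 := hf0 a fun h ↦ (lt_irrefl a h.1)
  have hfb : f b = 0 := hf0 b fun h ↦ (lt_irrefl b h.2)
  -- `f̂(z)` is the integral over `[a, b]`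
  have h0 : hat f z = ∫ u in a..b, f u * cexp (-(I * z * u)) := by
    rw [hat, intervalIntegral.integral_of_le hab, setIntegral_eq_integral_of_forall_compl_eq_zero]
    intro u hu
    rw [hf0 u fun h ↦ hu ⟨h.1, h.2.le⟩, zero_mul]
  have h1 := integral_deriv_mul_cexp_eq hab hfc hf1c hfa hfb hd1 z
  have h2 := integral_deriv_mul_cexp_eq hab hf1c hf2c hf1a hf1b hd2 z
  rw [h0]
  have hIz : I * z ≠ 0 := mul_ne_zero Complex.I_ne_zero hz
  rw [h1] at h2
  -- h2 : ∫ f₂ e = Iz (Iz ∫ f e)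
  have : (∫ u in a..b, f u * cexp (-(I * z * u))) = (I * z)⁻¹ * ((I * z)⁻¹ * ∫ u in a..b, f₂ u * cexp (-(I * z * u))) := by
    rw [h2]; field_simp
  rw [this]
  have hI2 : I ^ 2 = -1 := Complex.I_sq
  field_simp
  rw [hI2]
  ring

/-- **Second-order decay from two derivatives**: under the hypotheses of `hat_eq_of_hasDerivAt_two`
on a symmetric interval `[−R, R]`, `‖f̂(z)‖ ≤ e^{R|Im z|} (∫_{−R}^{R} ‖f₂‖)/‖z‖²`. [folklore] -/
private theorem norm_hat_le_of_hasDerivAt_two {f f₁ f₂ : ℝ → ℂ} {R : ℝ} (hR : 0 ≤ R)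
    (hf0 : ∀ u, u ∉ Ioo (-R) R → f u = 0)
    (hfc : ContinuousOn f (Icc (-R) R)) (hf1c : ContinuousOn f₁ (Icc (-R) R))
    (hf1a : f₁ (-R) = 0) (hf1b : f₁ R = 0)
    (hd1 : ∀ u ∈ Ioo (-R) R, HasDerivAt f (f₁ u) u) (hd2 : ∀ u ∈ Ioo (-R) R, HasDerivAt f₁ (f₂ u) u)
    (hf2c : ContinuousOn f₂ (Icc (-R) R)) {z : ℂ} (hz : z ≠ 0) :
    ‖hat f z‖ ≤ Real.exp (R * |z.im|) * (∫ u in (-R)..R, ‖f₂ u‖) / ‖z‖ ^ 2 := by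
  have hab : -R ≤ R := by linarith
  rw [hat_eq_of_hasDerivAt_two hab hf0 hfc hf1c hf1a hf1b hd1 hd2 hf2c hz, norm_mul, norm_neg,
    norm_div, norm_one, norm_pow]
  rw [div_eq_mul_inv, one_mul, mul_comm, ← div_eq_mul_inv]
  refine div_le_div_of_nonneg_right ?_ (by positivity)
  calc ‖∫ u in (-R)..R, f₂ u * cexp (-(I * z * u))‖
      ≤ ∫ u in (-R)..R, ‖f₂ u * cexp (-(I * z * u))‖ := intervalIntegral.norm_integral_le_integral_norm hab
    _ ≤ ∫ u in (-R)..R, Real.exp (R * |z.im|) * ‖f₂ u‖ := by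
        refine intervalIntegral.integral_mono_on hab ?_ ?_ fun u hu ↦ ?_
        · exact ((hf2c.mul (by fun_prop : Continuous fun u : ℝ ↦ cexp (-(I * z * u))).continuousOn).norm).intervalIntegrable_of_Icc hab
        · exact (continuousOn_const.mul hf2c.norm).intervalIntegrable_of_Icc hab
        · rw [norm_mul, Complex.norm_exp, mul_comm]
          refine mul_le_mul_of_nonneg_right (Real.exp_le_exp.2 ?_) (norm_nonneg _)
          have hre : (-(I * z * (u : ℂ))).re = z.im * u := by simp [Complex.mul_re]
          rw [hre]
          have hu' : |u| ≤ R := abs_le.2 ⟨hu.1, hu.2⟩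
          calc z.im * u ≤ |z.im| * |u| := by rw [← abs_mul]; exact le_abs_self _
            _ ≤ |z.im| * R := mul_le_mul_of_nonneg_left hu' (abs_nonneg _)
            _ = R * |z.im| := mul_comm _ _
    _ = Real.exp (R * |z.im|) * ∫ u in (-R)..R, ‖f₂ u‖ := intervalIntegral.integral_const_mul _ _


/-! ## §2. Flat `C²` ramps: `r ∈ C²(ℝ)`, `r = 0` on `(−∞, 0]`, `r = 1` on `[1, ∞)` -/

section Ramp

variable {r : ℝ → ℝ}

/-- Off `[0, 1]` a flat ramp is locally constant, so its derivative vanishes. [folklore] -/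
private theorem deriv_ramp_eq_zero (hr0 : ∀ x ≤ (0 : ℝ), r x = 0) (hr1 : ∀ x, (1 : ℝ) ≤ x → r x = 1)
    {x : ℝ} (hx : x < 0 ∨ 1 < x) : deriv r x = 0 := by
  rcases hx with hx | hx
  · have h : r =ᶠ[𝓝 x] fun _ ↦ (0 : ℝ) := by
      filter_upwards [Iio_mem_nhds hx] with t ht using hr0 t (le_of_lt ht)
    rw [h.deriv_eq, deriv_const]
  · have h : r =ᶠ[𝓝 x] fun _ ↦ (1 : ℝ) := by
      filter_upwards [Ioi_mem_nhds hx] with t ht using hr1 t (le_of_lt ht)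
    rw [h.deriv_eq, deriv_const]

/-- … hence so does its second derivative. [folklore] -/
private theorem deriv_deriv_ramp_eq_zero (hr0 : ∀ x ≤ (0 : ℝ), r x = 0)
    (hr1 : ∀ x, (1 : ℝ) ≤ x → r x = 1) {x : ℝ} (hx : x < 0 ∨ 1 < x) : deriv (deriv r) x = 0 := by
  rcases hx with hx | hx
  · have h : deriv r =ᶠ[𝓝 x] fun _ ↦ (0 : ℝ) := by
      filter_upwards [Iio_mem_nhds hx] with t ht using deriv_ramp_eq_zero hr0 hr1 (Or.inl ht)
    rw [h.deriv_eq, deriv_const]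
  · have h : deriv r =ᶠ[𝓝 x] fun _ ↦ (0 : ℝ) := by
      filter_upwards [Ioi_mem_nhds hx] with t ht using deriv_ramp_eq_zero hr0 hr1 (Or.inr ht)
    rw [h.deriv_eq, deriv_const]

/-- By continuity of `r′`, also `r′(0) = 0`. [folklore] -/
private theorem deriv_ramp_zero (hr : ContDiff ℝ 2 r) (hr0 : ∀ x ≤ (0 : ℝ), r x = 0)
    (hr1 : ∀ x, (1 : ℝ) ≤ x → r x = 1) : deriv r 0 = 0 := by
  have hc : Continuous (deriv r) := hr.continuous_deriv (by norm_num)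
  have hcl : IsClosed {x : ℝ | deriv r x = 0} := isClosed_eq hc continuous_const
  have hsub : Iio (0 : ℝ) ⊆ {x : ℝ | deriv r x = 0} := fun x hx ↦
    deriv_ramp_eq_zero hr0 hr1 (Or.inl hx)
  have h0 : (0 : ℝ) ∈ closure (Iio (0 : ℝ)) := by rw [closure_Iio]; exact self_mem_Iic
  exact hcl.closure_subset_iff.2 hsub h0

/-- A continuous function vanishing off `[0, 1]` is bounded and integrable. [folklore] -/
private theorem bounded_integrable_of_eq_zero_off {g : ℝ → ℝ} (hg : Continuous g)
    (hz : ∀ x : ℝ, x < 0 ∨ 1 < x → g x = 0) :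
    (∃ C : ℝ, 0 ≤ C ∧ ∀ x, |g x| ≤ C) ∧ Integrable g := by
  have hsupp : HasCompactSupport g := by
    refine HasCompactSupport.intro (isCompact_Icc (a := (0 : ℝ)) (b := 1)) fun x hx ↦ hz x ?_
    rw [mem_Icc, not_and_or, not_le, not_le] at hx
    exact hx
  refine ⟨?_, hg.integrable_of_hasCompactSupport hsupp⟩
  obtain ⟨C, hC⟩ := (isCompact_Icc (a := (0 : ℝ)) (b := 1)).exists_bound_of_continuousOn hg.continuousOn
  refine ⟨max C 0, le_max_right _ _, fun x ↦ ?_⟩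
  by_cases hx : x ∈ Icc (0 : ℝ) 1
  · exact (Real.norm_eq_abs _ ▸ hC x hx).trans (le_max_left _ _)
  · rw [mem_Icc, not_and_or, not_le, not_le] at hx
    rw [hz x hx, abs_zero]; exact le_max_right _ _

/-- The constants of a flat `C²` ramp: sup bounds for `r, r′`, and the `L¹` norms of `r′, r″`.
[folklore] -/
private theorem ramp_constants (hr : ContDiff ℝ 2 r) (hr0 : ∀ x ≤ (0 : ℝ), r x = 0)
    (hr1 : ∀ x, (1 : ℝ) ≤ x → r x = 1) :
    ∃ C₀ C₁ : ℝ, 0 ≤ C₀ ∧ 0 ≤ C₁ ∧ (∀ x, |r x| ≤ C₀) ∧ (∀ x, |deriv r x| ≤ C₁) ∧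
      Integrable (deriv r) ∧ Integrable (deriv (deriv r)) := by
  have hc0 : Continuous r := hr.continuous
  have hc1 : Continuous (deriv r) := hr.continuous_deriv (by norm_num)
  have hc2 : Continuous (deriv (deriv r)) := (hr.deriv').continuous_deriv le_rfl
  obtain ⟨⟨C₁, hC₁0, hC₁⟩, hi1⟩ := bounded_integrable_of_eq_zero_off hc1
    (fun x hx ↦ deriv_ramp_eq_zero hr0 hr1 hx)
  obtain ⟨-, hi2⟩ := bounded_integrable_of_eq_zero_off hc2
    (fun x hx ↦ deriv_deriv_ramp_eq_zero hr0 hr1 hx)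
  -- sup of `|r|`: `≤ max(1, sup_{[0,1]} |r|)`
  obtain ⟨C, hC⟩ := (isCompact_Icc (a := (0 : ℝ)) (b := 1)).exists_bound_of_continuousOn hc0.continuousOn
  refine ⟨max C 1, C₁, le_trans zero_le_one (le_max_right _ _), hC₁0, fun x ↦ ?_, hC₁, hi1, hi2⟩
  by_cases hx : x ∈ Icc (0 : ℝ) 1
  · exact (Real.norm_eq_abs _ ▸ hC x hx).trans (le_max_left _ _)
  · rw [mem_Icc, not_and_or, not_le, not_le] at hx
    rcases hx with hx | hx
    · rw [hr0 x hx.le, abs_zero]; positivity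
    · rw [hr1 x hx.le, abs_one]; exact le_max_right _ _

end Ramp

/-! ## §3. The two-sided product `P(u) = r(L/2 + u) r(L/2 − u)` and its derivatives -/

section Product

variable {r : ℝ → ℝ}

/-- `P′ = r′(L/2+u) r(L/2−u) − r(L/2+u) r′(L/2−u)`. [folklore] -/
private theorem hasDerivAt_rampProd (hr : ContDiff ℝ 2 r) (L u : ℝ) :
    HasDerivAt (fun u : ℝ ↦ r (L / 2 + u) * r (L / 2 - u))
      (deriv r (L / 2 + u) * r (L / 2 - u) - r (L / 2 + u) * deriv r (L / 2 - u)) u := by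
  have hd : Differentiable ℝ r := hr.differentiable (by norm_num)
  have h1 : HasDerivAt (fun u : ℝ ↦ r (L / 2 + u)) (deriv r (L / 2 + u)) u :=
    HasDerivAt.comp_const_add (L / 2) u (hd (L / 2 + u)).hasDerivAt
  have h2 : HasDerivAt (fun u : ℝ ↦ r (L / 2 - u)) (-deriv r (L / 2 - u)) u :=
    HasDerivAt.comp_const_sub (L / 2) u (hd (L / 2 - u)).hasDerivAt
  exact (h1.mul h2).congr_deriv (by ring)

/-- `P″ = r″(L/2+u) r(L/2−u) − 2 r′(L/2+u) r′(L/2−u) + r(L/2+u) r″(L/2−u)`. [folklore] -/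
private theorem hasDerivAt_rampProd_deriv (hr : ContDiff ℝ 2 r) (L u : ℝ) :
    HasDerivAt (fun u : ℝ ↦ deriv r (L / 2 + u) * r (L / 2 - u) - r (L / 2 + u) * deriv r (L / 2 - u))
      (deriv (deriv r) (L / 2 + u) * r (L / 2 - u) - 2 * (deriv r (L / 2 + u) * deriv r (L / 2 - u)) +
        r (L / 2 + u) * deriv (deriv r) (L / 2 - u)) u := by
  have hd : Differentiable ℝ r := hr.differentiable (by norm_num)
  have hd' : Differentiable ℝ (deriv r) := hr.differentiable_deriv_two
  have h1 : HasDerivAt (fun u : ℝ ↦ r (L / 2 + u)) (deriv r (L / 2 + u)) u :=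
    HasDerivAt.comp_const_add (L / 2) u (hd (L / 2 + u)).hasDerivAt
  have h2 : HasDerivAt (fun u : ℝ ↦ r (L / 2 - u)) (-deriv r (L / 2 - u)) u :=
    HasDerivAt.comp_const_sub (L / 2) u (hd (L / 2 - u)).hasDerivAt
  have h1' : HasDerivAt (fun u : ℝ ↦ deriv r (L / 2 + u)) (deriv (deriv r) (L / 2 + u)) u :=
    HasDerivAt.comp_const_add (L / 2) u (hd' (L / 2 + u)).hasDerivAt
  have h2' : HasDerivAt (fun u : ℝ ↦ deriv r (L / 2 - u)) (-deriv (deriv r) (L / 2 - u)) u :=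
    HasDerivAt.comp_const_sub (L / 2) u (hd' (L / 2 - u)).hasDerivAt
  exact ((h1'.mul h2).sub (h1.mul h2')).congr_deriv (by ring)

/-- `∫_ℝ |g(L/2 + u) h(L/2 − u)| du ≤ C ∫_ℝ |g|` when `|h| ≤ C` and `g` is integrable. [folklore] -/
private theorem integral_abs_shift_mul_le {g h : ℝ → ℝ} (hg : Integrable g) (hh : Continuous h)
    {C : ℝ} (hC : ∀ x, |h x| ≤ C) (L : ℝ) :
    Integrable (fun u : ℝ ↦ g (L / 2 + u) * h (L / 2 - u)) ∧
      ∫ u : ℝ, |g (L / 2 + u) * h (L / 2 - u)| ≤ C * ∫ x : ℝ, |g x| := by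
  have hgi : Integrable (fun u : ℝ ↦ g (L / 2 + u)) := hg.comp_add_left (L / 2)
  have hint : Integrable (fun u : ℝ ↦ g (L / 2 + u) * h (L / 2 - u)) := by
    refine hgi.mul_bdd (c := C) (hh.comp (continuous_const.sub continuous_id)).aestronglyMeasurable
      (Eventually.of_forall fun u ↦ ?_)
    rw [Real.norm_eq_abs]; exact hC _
  refine ⟨hint, ?_⟩
  calc ∫ u : ℝ, |g (L / 2 + u) * h (L / 2 - u)| ≤ ∫ u : ℝ, C * |g (L / 2 + u)| := by
        refine integral_mono hint.abs (hgi.abs.const_mul C) fun u ↦ ?_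
        dsimp only
        rw [abs_mul, mul_comm]
        exact mul_le_mul_of_nonneg_right (hC _) (abs_nonneg _)
    _ = C * ∫ x : ℝ, |g x| := by
        rw [MeasureTheory.integral_const_mul]
        congr 1
        exact integral_add_left_eq_self (fun x ↦ |g x|) (L / 2)

/-- The mirror version `∫_ℝ |g(L/2 + u) h(L/2 − u)| du ≤ C ∫_ℝ |h|` when `|g| ≤ C`. [folklore] -/
private theorem integral_abs_shift_mul_le' {g h : ℝ → ℝ} (hg : Continuous g) (hh : Integrable h)
    {C : ℝ} (hC : ∀ x, |g x| ≤ C) (L : ℝ) :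
    Integrable (fun u : ℝ ↦ g (L / 2 + u) * h (L / 2 - u)) ∧
      ∫ u : ℝ, |g (L / 2 + u) * h (L / 2 - u)| ≤ C * ∫ x : ℝ, |h x| := by
  have hhi : Integrable (fun u : ℝ ↦ h (L / 2 - u)) := hh.comp_sub_left (L / 2)
  have hint : Integrable (fun u : ℝ ↦ g (L / 2 + u) * h (L / 2 - u)) := by
    refine hhi.bdd_mul (c := C) (hg.comp (continuous_const.add continuous_id)).aestronglyMeasurable
      (Eventually.of_forall fun u ↦ ?_)
    rw [Real.norm_eq_abs]; exact hC _
  refine ⟨hint, ?_⟩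
  calc ∫ u : ℝ, |g (L / 2 + u) * h (L / 2 - u)| ≤ ∫ u : ℝ, C * |h (L / 2 - u)| := by
        refine integral_mono hint.abs (hhi.abs.const_mul C) fun u ↦ ?_
        dsimp only
        rw [abs_mul]
        exact mul_le_mul_of_nonneg_right (hC _) (abs_nonneg _)
    _ = C * ∫ x : ℝ, |h x| := by
        rw [MeasureTheory.integral_const_mul]
        congr 1
        exact integral_sub_left_eq_self (fun x ↦ |h x|) volume (L / 2)

end Product

/-! ## §4. The core `q ∘ clampHalf(·/L)` and the generic decay theorem -/

section Core

variable {q : ℝ → ℝ}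

/-- On `(−L/2, L/2)` the clamp is inactive: `clampHalf(v/L) = v/L` near any such point. [folklore] -/
private theorem clampHalf_div_eventuallyEq {L u : ℝ} (hL : 0 < L) (hu : u ∈ Ioo (-(L / 2)) (L / 2)) :
    (fun v : ℝ ↦ clampHalf (v / L)) =ᶠ[𝓝 u] fun v ↦ v / L := by
  filter_upwards [Ioo_mem_nhds hu.1 hu.2] with v hv
  refine clampHalf_of_mem ⟨?_, ?_⟩
  · rw [le_div_iff₀ hL]; linarith [hv.1]
  · rw [div_le_iff₀ hL]; linarith [hv.2]

/-- `u ∈ (−L/2, L/2) ⇒ u/L ∈ (−½, ½)`. [folklore] -/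
private theorem div_mem_Ioo_half {L u : ℝ} (hL : 0 < L) (hu : u ∈ Ioo (-(L / 2)) (L / 2)) :
    u / L ∈ Ioo (-(1 / 2 : ℝ)) (1 / 2) := by
  constructor
  · rw [lt_div_iff₀ hL]; linarith [hu.1]
  · rw [div_lt_iff₀ hL]; linarith [hu.2]

/-- Chain rule through the clamp: if `q` has derivative `q′(u/L)` at `u/L ∈ (−½, ½)` then
`v ↦ q(clampHalf(v/L))` has derivative `q′(u/L)/L` at `u`. [folklore] -/
private theorem hasDerivAt_comp_clampHalf {q : ℝ → ℝ} {q' L u : ℝ} (hL : 0 < L)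
    (hu : u ∈ Ioo (-(L / 2)) (L / 2)) (hq : HasDerivAt q q' (u / L)) :
    HasDerivAt (fun v : ℝ ↦ q (clampHalf (v / L))) (q' / L) u := by
  have h1 : HasDerivAt (fun v : ℝ ↦ q (v / L)) (q' / L) u := by
    have := hq.comp u ((hasDerivAt_id u).div_const L)
    simpa [Function.comp_def, div_eq_mul_inv, mul_comm] using this
  refine h1.congr_of_eventuallyEq ?_
  filter_upwards [clampHalf_div_eventuallyEq hL hu] with v hv
  rw [hv]

/-- Interior derivative from `ContDiffOn` data on `[−½, ½]`: for `x ∈ (−½, ½)`,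
`HasDerivAt q (derivWithin q [−½,½] x) x`. [folklore] -/
private theorem hasDerivAt_of_differentiableOn_Icc {q : ℝ → ℝ}
    (hq : DifferentiableOn ℝ q (Icc (-(1 / 2 : ℝ)) (1 / 2))) {x : ℝ} (hx : x ∈ Ioo (-(1 / 2 : ℝ)) (1 / 2)) :
    HasDerivAt q (derivWithin q (Icc (-(1 / 2 : ℝ)) (1 / 2)) x) x := by
  have hmem : Icc (-(1 / 2 : ℝ)) (1 / 2) ∈ 𝓝 x := Icc_mem_nhds hx.1 hx.2
  exact ((hq x (Ioo_subset_Icc_self hx)).hasDerivWithinAt).hasDerivAt hmem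

/-- **Generic second-order decay for window-built test functions.** Let `r` be a flat `C²` ramp and
`q` be `C²` on `[−½, ½]`. Then there is `C ≥ 0` such that for every `L ≥ 1` and `z ≠ 0`, the function
`W(u) = r(L/2 + u) r(L/2 − u) q(clampHalf(u/L))` satisfies `‖Ŵ(z)‖ ≤ C e^{(L/2)|Im z|}/‖z‖²`
(two integrations by parts on `(−L/2, L/2)`; the `L¹` norm of `W″` is bounded uniformly in `L`
because the ramp derivatives live on two unit intervals and the core contributes `O(1/L)`).
[cite: AlpogeFurman2026, §2.2 eq. (2.8) (p. 4)] -/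
theorem exists_norm_hat_rampWindow_le {r q : ℝ → ℝ} (hr : ContDiff ℝ 2 r)
    (hr0 : ∀ x ≤ (0 : ℝ), r x = 0) (hr1 : ∀ x, (1 : ℝ) ≤ x → r x = 1)
    (hq : ContDiffOn ℝ 2 q (Icc (-(1 / 2 : ℝ)) (1 / 2))) :
    ∃ C : ℝ, 0 ≤ C ∧ ∀ L : ℝ, 1 ≤ L → ∀ z : ℂ, z ≠ 0 →
      ‖hat (fun u ↦ ((r (L / 2 + u) * r (L / 2 - u) * q (clampHalf (u / L)) : ℝ) : ℂ)) z‖ ≤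
        C * Real.exp (L / 2 * |z.im|) / ‖z‖ ^ 2 := by
  -- constants of the ramp
  obtain ⟨C₀, C₁, hC₀, hC₁, hrC₀, hrC₁, hi1, hi2⟩ := ramp_constants hr hr0 hr1
  set I₁ : ℝ := ∫ x : ℝ, |deriv r x| with hI₁
  set I₂ : ℝ := ∫ x : ℝ, |deriv (deriv r) x| with hI₂
  have hI₁0 : 0 ≤ I₁ := integral_nonneg fun x ↦ abs_nonneg _
  have hI₂0 : 0 ≤ I₂ := integral_nonneg fun x ↦ abs_nonneg _
  have hrc : Continuous r := hr.continuous
  have hrc1 : Continuous (deriv r) := hr.continuous_deriv (by norm_num)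
  have hrc2 : Continuous (deriv (deriv r)) := (hr.deriv').continuous_deriv le_rfl
  -- constants of the core
  set J : Set ℝ := Icc (-(1 / 2 : ℝ)) (1 / 2) with hJ
  have hJu : UniqueDiffOn ℝ J := uniqueDiffOn_Icc (by norm_num)
  have hJc : IsCompact J := isCompact_Icc
  set q₁ : ℝ → ℝ := derivWithin q J with hq₁
  set q₂ : ℝ → ℝ := derivWithin q₁ J with hq₂
  have hq1 : ContDiffOn ℝ 1 q₁ J := hq.derivWithin hJu (by norm_num)
  have hqc : ContinuousOn q J := hq.continuousOn
  have hq1c : ContinuousOn q₁ J := hq.continuousOn_derivWithin hJu (by norm_num)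
  have hq2c : ContinuousOn q₂ J := hq1.continuousOn_derivWithin hJu le_rfl
  have hqd : DifferentiableOn ℝ q J := hq.differentiableOn (by norm_num)
  have hq1d : DifferentiableOn ℝ q₁ J := hq1.differentiableOn one_ne_zero
  obtain ⟨B₀, hB₀⟩ := hJc.exists_bound_of_continuousOn hqc
  obtain ⟨B₁, hB₁⟩ := hJc.exists_bound_of_continuousOn hq1c
  obtain ⟨B₂, hB₂⟩ := hJc.exists_bound_of_continuousOn hq2c
  have hB₀0 : 0 ≤ B₀ := (norm_nonneg _).trans (hB₀ 0 (by rw [hJ]; norm_num))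
  have hB₁0 : 0 ≤ B₁ := (norm_nonneg _).trans (hB₁ 0 (by rw [hJ]; norm_num))
  have hB₂0 : 0 ≤ B₂ := (norm_nonneg _).trans (hB₂ 0 (by rw [hJ]; norm_num))
  -- the constant
  refine ⟨B₀ * (2 * C₀ * I₂ + 2 * C₁ * I₁) + 2 * B₁ * (2 * C₀ * I₁) + C₀ ^ 2 * B₂, by positivity,
    fun L hL z hz ↦ ?_⟩
  have hL0 : 0 < L := by linarith
  -- the functions
  set P : ℝ → ℝ := fun u ↦ r (L / 2 + u) * r (L / 2 - u) with hP
  set P₁ : ℝ → ℝ := fun u ↦ deriv r (L / 2 + u) * r (L / 2 - u) - r (L / 2 + u) * deriv r (L / 2 - u)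
    with hP₁
  set P₂ : ℝ → ℝ := fun u ↦ deriv (deriv r) (L / 2 + u) * r (L / 2 - u) -
    2 * (deriv r (L / 2 + u) * deriv r (L / 2 - u)) + r (L / 2 + u) * deriv (deriv r) (L / 2 - u) with hP₂
  set Q : ℝ → ℝ := fun u ↦ q (clampHalf (u / L)) with hQ
  set Q₁ : ℝ → ℝ := fun u ↦ q₁ (clampHalf (u / L)) / L with hQ₁
  set Q₂ : ℝ → ℝ := fun u ↦ q₂ (clampHalf (u / L)) / L ^ 2 with hQ₂
  set f : ℝ → ℂ := fun u ↦ ((P u * Q u : ℝ) : ℂ) with hf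
  set f₁ : ℝ → ℂ := fun u ↦ ((P₁ u * Q u + P u * Q₁ u : ℝ) : ℂ) with hf₁
  set f₂ : ℝ → ℂ := fun u ↦ ((P₂ u * Q u + 2 * (P₁ u * Q₁ u) + P u * Q₂ u : ℝ) : ℂ) with hf₂
  -- continuity
  have hPc : Continuous P := by rw [hP]; fun_prop
  have hP₁c : Continuous P₁ := by rw [hP₁]; fun_prop
  have hP₂c : Continuous P₂ := by rw [hP₂]; fun_prop
  have hcl : Continuous fun u : ℝ ↦ clampHalf (u / L) := continuous_clampHalf.comp (continuous_id.div_const L)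
  have hQc : Continuous Q := hqc.comp_continuous hcl fun u ↦ clampHalf_mem _
  have hQ₁c : Continuous Q₁ := (hq1c.comp_continuous hcl fun u ↦ clampHalf_mem _).div_const L
  have hQ₂c : Continuous Q₂ := (hq2c.comp_continuous hcl fun u ↦ clampHalf_mem _).div_const (L ^ 2)
  have hfc : Continuous f := by rw [hf]; exact Complex.continuous_ofReal.comp (hPc.mul hQc)
  have hf₁c : Continuous f₁ := by
    rw [hf₁]; exact Complex.continuous_ofReal.comp ((hP₁c.mul hQc).add (hPc.mul hQ₁c))
  have hf₂c : Continuous f₂ := by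
    rw [hf₂]
    exact Complex.continuous_ofReal.comp (((hP₂c.mul hQc).add (continuous_const.mul (hP₁c.mul hQ₁c))).add
      (hPc.mul hQ₂c))
  -- vanishing of `f` off `(−L/2, L/2)` and of `f₁` at the endpoints
  have hP0 : ∀ u, u ∉ Ioo (-(L / 2)) (L / 2) → P u = 0 := by
    intro u hu
    rw [mem_Ioo, not_and_or, not_lt, not_lt] at hu
    simp only [hP]
    rcases hu with hu | hu
    · rw [hr0 (L / 2 + u) (by linarith), zero_mul]
    · rw [hr0 (L / 2 - u) (by linarith), mul_zero]
  have hf0 : ∀ u, u ∉ Ioo (-(L / 2)) (L / 2) → f u = 0 := by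
    intro u hu; simp only [hf, hP0 u hu, zero_mul, Complex.ofReal_zero]
  have hr'0 : deriv r 0 = 0 := deriv_ramp_zero hr hr0 hr1
  have hP₁a : P₁ (-(L / 2)) = 0 := by
    simp only [hP₁]
    rw [show L / 2 + -(L / 2) = 0 by ring, hr'0, hr0 0 le_rfl]; ring
  have hP₁b : P₁ (L / 2) = 0 := by
    simp only [hP₁]
    rw [show L / 2 - L / 2 = 0 by ring, hr'0, hr0 0 le_rfl]; ring
  have hf₁a : f₁ (-(L / 2)) = 0 := by
    simp only [hf₁, hP₁a, hP0 (-(L / 2)) (fun h ↦ lt_irrefl _ h.1)]; simp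
  have hf₁b : f₁ (L / 2) = 0 := by
    simp only [hf₁, hP₁b, hP0 (L / 2) (fun h ↦ lt_irrefl _ h.2)]; simp
  -- derivatives on the open interval
  have hd1 : ∀ u ∈ Ioo (-(L / 2)) (L / 2), HasDerivAt f (f₁ u) u := by
    intro u hu
    have hx := div_mem_Ioo_half hL0 hu
    have hcl : clampHalf (u / L) = u / L := clampHalf_of_mem (Ioo_subset_Icc_self hx)
    have hPd : HasDerivAt P (P₁ u) u := hasDerivAt_rampProd hr L u
    have hQd : HasDerivAt Q (q₁ (u / L) / L) u :=
      hasDerivAt_comp_clampHalf hL0 hu (hasDerivAt_of_differentiableOn_Icc hqd hx)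
    have h := (hPd.mul hQd).ofReal_comp
    have e : f₁ u = ((P₁ u * Q u + P u * (q₁ (u / L) / L) : ℝ) : ℂ) := by
      simp only [hf₁, hQ₁, hcl]
    rw [e]
    exact h
  have hd2 : ∀ u ∈ Ioo (-(L / 2)) (L / 2), HasDerivAt f₁ (f₂ u) u := by
    intro u hu
    have hx := div_mem_Ioo_half hL0 hu
    have hcl : clampHalf (u / L) = u / L := clampHalf_of_mem (Ioo_subset_Icc_self hx)
    have hPd : HasDerivAt P (P₁ u) u := hasDerivAt_rampProd hr L u
    have hP₁d : HasDerivAt P₁ (P₂ u) u := hasDerivAt_rampProd_deriv hr L u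
    have hQd : HasDerivAt Q (q₁ (u / L) / L) u :=
      hasDerivAt_comp_clampHalf hL0 hu (hasDerivAt_of_differentiableOn_Icc hqd hx)
    have hQ₁d : HasDerivAt Q₁ (q₂ (u / L) / L / L) u := by
      have h := hasDerivAt_comp_clampHalf hL0 hu (hasDerivAt_of_differentiableOn_Icc hq1d hx)
      exact h.div_const L
    have h := ((hP₁d.mul hQd).add (hPd.mul hQ₁d)).ofReal_comp
    have e : f₂ u = ((P₂ u * Q u + 2 * (P₁ u * (q₁ (u / L) / L)) + P u * (q₂ (u / L) / L / L) : ℝ) : ℂ) := by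
      simp only [hf₂, hQ₁, hQ₂, hcl]
      push_cast
      ring
    rw [e]
    refine h.congr_deriv ?_
    simp only [hQ₁, hcl]
    push_cast
    ring
  -- the decay bound from §1
  have hR : 0 ≤ L / 2 := by linarith
  have hmain := norm_hat_le_of_hasDerivAt_two hR hf0 hfc.continuousOn hf₁c.continuousOn hf₁a hf₁b
    hd1 hd2 hf₂c.continuousOn hz
  refine hmain.trans ?_
  rw [show L / 2 * |z.im| = L / 2 * |z.im| from rfl]
  have hexp : 0 ≤ Real.exp (L / 2 * |z.im|) := Real.exp_nonneg _
  rw [mul_comm (Real.exp _)]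
  refine div_le_div_of_nonneg_right (mul_le_mul_of_nonneg_right ?_ hexp) (by positivity)
  -- `∫_{−L/2}^{L/2} ‖f₂‖ ≤ C`
  -- pointwise bounds for the core
  have hQb : ∀ u, |Q u| ≤ B₀ := fun u ↦ by
    have := hB₀ _ (clampHalf_mem (u / L)); rwa [Real.norm_eq_abs] at this
  have hQ₁b : ∀ u, |Q₁ u| ≤ B₁ / L := fun u ↦ by
    have := hB₁ _ (clampHalf_mem (u / L)); rw [Real.norm_eq_abs] at this
    simp only [hQ₁]; rw [abs_div, abs_of_pos hL0]; exact div_le_div_of_nonneg_right this hL0.le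
  have hQ₂b : ∀ u, |Q₂ u| ≤ B₂ / L ^ 2 := fun u ↦ by
    have := hB₂ _ (clampHalf_mem (u / L)); rw [Real.norm_eq_abs] at this
    simp only [hQ₂]; rw [abs_div, abs_of_pos (by positivity : (0 : ℝ) < L ^ 2)]
    exact div_le_div_of_nonneg_right this (by positivity)
  have hPb : ∀ u, |P u| ≤ C₀ ^ 2 := fun u ↦ by
    simp only [hP]; rw [abs_mul, sq]
    exact mul_le_mul (hrC₀ _) (hrC₀ _) (abs_nonneg _) hC₀
  -- `L¹` bounds for `P₁`, `P₂` over `ℝ`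
  have hP₁i : Integrable P₁ ∧ ∫ u : ℝ, |P₁ u| ≤ 2 * C₀ * I₁ := by
    obtain ⟨i1, b1⟩ := integral_abs_shift_mul_le hi1 hrc hrC₀ L
    obtain ⟨i2, b2⟩ := integral_abs_shift_mul_le' hrc hi1 hrC₀ L
    refine ⟨?_, ?_⟩
    · simp only [hP₁]; exact i1.sub i2
    · simp only [hP₁]
      calc ∫ u : ℝ, |deriv r (L / 2 + u) * r (L / 2 - u) - r (L / 2 + u) * deriv r (L / 2 - u)|
          ≤ ∫ u : ℝ, |deriv r (L / 2 + u) * r (L / 2 - u)| + |r (L / 2 + u) * deriv r (L / 2 - u)| :=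
            integral_mono (i1.sub i2).abs (i1.abs.add i2.abs) fun u ↦ abs_sub _ _
        _ = (∫ u : ℝ, |deriv r (L / 2 + u) * r (L / 2 - u)|) + ∫ u : ℝ, |r (L / 2 + u) * deriv r (L / 2 - u)| :=
            integral_add i1.abs i2.abs
        _ ≤ C₀ * I₁ + C₀ * I₁ := add_le_add b1 b2
        _ = 2 * C₀ * I₁ := by ring
  have hP₂i : Integrable P₂ ∧ ∫ u : ℝ, |P₂ u| ≤ 2 * C₀ * I₂ + 2 * C₁ * I₁ := by
    obtain ⟨i1, b1⟩ := integral_abs_shift_mul_le hi2 hrc hrC₀ L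
    obtain ⟨i2, b2⟩ := integral_abs_shift_mul_le hi1 hrc1 hrC₁ L
    obtain ⟨i3, b3⟩ := integral_abs_shift_mul_le' hrc hi2 hrC₀ L
    have i2' : Integrable fun u : ℝ ↦ 2 * (deriv r (L / 2 + u) * deriv r (L / 2 - u)) := i2.const_mul 2
    refine ⟨?_, ?_⟩
    · simp only [hP₂]; exact (i1.sub i2').add i3
    · simp only [hP₂]
      calc ∫ u : ℝ, |deriv (deriv r) (L / 2 + u) * r (L / 2 - u) -
              2 * (deriv r (L / 2 + u) * deriv r (L / 2 - u)) + r (L / 2 + u) * deriv (deriv r) (L / 2 - u)|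
          ≤ ∫ u : ℝ, (|deriv (deriv r) (L / 2 + u) * r (L / 2 - u)| +
              2 * |deriv r (L / 2 + u) * deriv r (L / 2 - u)|) +
              |r (L / 2 + u) * deriv (deriv r) (L / 2 - u)| := by
            have iAB : Integrable fun u : ℝ ↦ |deriv (deriv r) (L / 2 + u) * r (L / 2 - u)| +
                2 * |deriv r (L / 2 + u) * deriv r (L / 2 - u)| := i1.abs.add (i2.abs.const_mul 2)
            refine integral_mono ((i1.sub i2').add i3).abs (iAB.add i3.abs) fun u ↦ ?_
            dsimp only
            have := abs_add_le (deriv (deriv r) (L / 2 + u) * r (L / 2 - u) -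
              2 * (deriv r (L / 2 + u) * deriv r (L / 2 - u))) (r (L / 2 + u) * deriv (deriv r) (L / 2 - u))
            have h' := abs_sub (deriv (deriv r) (L / 2 + u) * r (L / 2 - u))
              (2 * (deriv r (L / 2 + u) * deriv r (L / 2 - u)))
            rw [abs_mul (2 : ℝ), abs_two] at h'
            linarith
        _ = ((∫ u : ℝ, |deriv (deriv r) (L / 2 + u) * r (L / 2 - u)|) +
              2 * ∫ u : ℝ, |deriv r (L / 2 + u) * deriv r (L / 2 - u)|) +
              ∫ u : ℝ, |r (L / 2 + u) * deriv (deriv r) (L / 2 - u)| := by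
            have iAB : Integrable fun u : ℝ ↦ |deriv (deriv r) (L / 2 + u) * r (L / 2 - u)| +
                2 * |deriv r (L / 2 + u) * deriv r (L / 2 - u)| := i1.abs.add (i2.abs.const_mul 2)
            rw [integral_add iAB i3.abs, integral_add i1.abs (i2.abs.const_mul 2),
              MeasureTheory.integral_const_mul]
        _ ≤ (C₀ * I₂ + 2 * (C₁ * I₁)) + C₀ * I₂ := by gcongr
        _ = 2 * C₀ * I₂ + 2 * C₁ * I₁ := by ring
  -- assemble the `L¹` bound on `[−L/2, L/2]`
  have hab : -(L / 2) ≤ L / 2 := by linarith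
  have hnorm : ∀ u, ‖f₂ u‖ ≤ B₀ * |P₂ u| + 2 * (B₁ / L) * |P₁ u| + C₀ ^ 2 * (B₂ / L ^ 2) := by
    intro u
    simp only [hf₂]
    rw [Complex.norm_real, Real.norm_eq_abs]
    have h1 : |P₂ u * Q u| ≤ B₀ * |P₂ u| := by
      rw [abs_mul, mul_comm]; exact mul_le_mul_of_nonneg_right (hQb u) (abs_nonneg _)
    have h2 : |2 * (P₁ u * Q₁ u)| ≤ 2 * (B₁ / L) * |P₁ u| := by
      rw [abs_mul, abs_two, abs_mul, mul_assoc]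
      refine mul_le_mul_of_nonneg_left ?_ (by norm_num)
      rw [mul_comm]; exact mul_le_mul_of_nonneg_right (hQ₁b u) (abs_nonneg _)
    have h3 : |P u * Q₂ u| ≤ C₀ ^ 2 * (B₂ / L ^ 2) := by
      rw [abs_mul]; exact mul_le_mul (hPb u) (hQ₂b u) (abs_nonneg _) (by positivity)
    have := abs_add_three (P₂ u * Q u) (2 * (P₁ u * Q₁ u)) (P u * Q₂ u)
    linarith
  have hi_f₂ : IntervalIntegrable (fun u ↦ ‖f₂ u‖) volume (-(L / 2)) (L / 2) :=
    hf₂c.norm.intervalIntegrable _ _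
  have hi_rhs : IntervalIntegrable (fun u ↦ B₀ * |P₂ u| + 2 * (B₁ / L) * |P₁ u| + C₀ ^ 2 * (B₂ / L ^ 2))
      volume (-(L / 2)) (L / 2) :=
    (((hP₂c.abs.const_mul _).add (hP₁c.abs.const_mul _)).add continuous_const).intervalIntegrable _ _
  calc ∫ u in (-(L / 2))..(L / 2), ‖f₂ u‖
      ≤ ∫ u in (-(L / 2))..(L / 2), (B₀ * |P₂ u| + 2 * (B₁ / L) * |P₁ u| + C₀ ^ 2 * (B₂ / L ^ 2)) :=
        intervalIntegral.integral_mono_on hab hi_f₂ hi_rhs fun u _ ↦ hnorm u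
    _ = B₀ * (∫ u in (-(L / 2))..(L / 2), |P₂ u|) + 2 * (B₁ / L) * (∫ u in (-(L / 2))..(L / 2), |P₁ u|) +
          C₀ ^ 2 * (B₂ / L ^ 2) * L := by
        rw [intervalIntegral.integral_add, intervalIntegral.integral_add, intervalIntegral.integral_const_mul,
          intervalIntegral.integral_const_mul, intervalIntegral.integral_const]
        · simp only [smul_eq_mul]; ring
        · exact (hP₂c.abs.const_mul _).intervalIntegrable _ _
        · exact (hP₁c.abs.const_mul _).intervalIntegrable _ _
        · exact ((hP₂c.abs.const_mul _).add (hP₁c.abs.const_mul _)).intervalIntegrable _ _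
        · exact continuous_const.intervalIntegrable _ _
    _ ≤ B₀ * (2 * C₀ * I₂ + 2 * C₁ * I₁) + 2 * (B₁ / L) * (2 * C₀ * I₁) + C₀ ^ 2 * (B₂ / L ^ 2) * L := by
        have e1 : ∫ u in (-(L / 2))..(L / 2), |P₂ u| ≤ 2 * C₀ * I₂ + 2 * C₁ * I₁ := by
          rw [intervalIntegral.integral_of_le hab]
          exact (setIntegral_le_integral hP₂i.1.abs (Eventually.of_forall fun u ↦ abs_nonneg _)).trans hP₂i.2
        have e2 : ∫ u in (-(L / 2))..(L / 2), |P₁ u| ≤ 2 * C₀ * I₁ := by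
          rw [intervalIntegral.integral_of_le hab]
          exact (setIntegral_le_integral hP₁i.1.abs (Eventually.of_forall fun u ↦ abs_nonneg _)).trans hP₁i.2
        have : 0 ≤ 2 * (B₁ / L) := by positivity
        gcongr
    _ ≤ B₀ * (2 * C₀ * I₂ + 2 * C₁ * I₁) + 2 * B₁ * (2 * C₀ * I₁) + C₀ ^ 2 * B₂ := by
        have h1 : 2 * (B₁ / L) * (2 * C₀ * I₁) ≤ 2 * B₁ * (2 * C₀ * I₁) := by
          have : B₁ / L ≤ B₁ := div_le_self hB₁0 hL
          have : 0 ≤ 2 * C₀ * I₁ := by positivity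
          nlinarith
        have h2 : C₀ ^ 2 * (B₂ / L ^ 2) * L ≤ C₀ ^ 2 * B₂ := by
          rw [show C₀ ^ 2 * (B₂ / L ^ 2) * L = C₀ ^ 2 * B₂ * (1 / L) by field_simp]
          have : 1 / L ≤ 1 := by rw [div_le_one hL0]; exact hL
          have : 0 ≤ C₀ ^ 2 * B₂ := by positivity
          nlinarith
        linarith

end Core


/-! ## §5. [AF26] (2.8) for the typed window: `|φ̂(z)| ≪ e^{L|Im z|/2}/|z|²`, and the same for `Φ = (φ²)^` -/

section Window

variable {ψ : ℝ → ℝ}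

/-- The squared ramp `χ²` is again a flat `C²` ramp. [cite: AlpogeFurman2026, §2.2 (p. 4)] -/
theorem smoothRamp_sq_ramp :
    ContDiff ℝ 2 (fun x ↦ smoothRamp x ^ 2) ∧ (∀ x ≤ (0 : ℝ), smoothRamp x ^ 2 = 0) ∧
      (∀ x, (1 : ℝ) ≤ x → smoothRamp x ^ 2 = 1) := by
  refine ⟨contDiff_smoothRamp.pow 2, fun x hx ↦ by rw [smoothRamp_of_nonpos hx]; ring,
    fun x hx ↦ by rw [smoothRamp_of_one_le hx]; ring⟩

/-- For a window, `√ψ` is `C²` on `[−½, ½]` (`ψ` is `C²` and positive there). [cite: AlpogeFurman2026, §2.2 (p. 4)] -/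
theorem IsWindow.contDiffOn_sqrt (hψ : IsWindow ψ) :
    ContDiffOn ℝ 2 (fun x ↦ Real.sqrt (ψ x)) (Icc (-(1 / 2 : ℝ)) (1 / 2)) :=
  hψ.contDiffOn.sqrt fun x hx ↦ (hψ.pos x hx).ne'

/-- **[AF26] eq. (2.8), second-order decay of `φ̂` for the typed test function**: for a window `ψ`
there is `C` such that for every `T` with `L = log(T/2π) ≥ 1` and every `z ≠ 0`,
`|φ̂_T(z)| ≤ C e^{(L/2)|Im z|}/|z|²` (the printed `|φ̂(z)| ≪_χ e^{L|Im z|/2} min(L, |z|⁻¹, |z|⁻²)`,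
`|z|⁻²` branch; the `L` and `|z|⁻¹` branches are `norm_hat_phi_le_trivial`-type bounds and the tree's
`norm_hat_phi_le`). PROVED by two integrations by parts. [cite: AlpogeFurman2026, §2.2 eq. (2.8) (p. 4)] -/
theorem exists_norm_hat_phi_le_inv_sq (hψ : IsWindow ψ) :
    ∃ C : ℝ, 0 ≤ C ∧ ∀ T : ℝ, 1 ≤ logHeight T → ∀ z : ℂ, z ≠ 0 →
      ‖hat (fun u ↦ (phi ψ T u : ℂ)) z‖ ≤ C * Real.exp (logHeight T / 2 * |z.im|) / ‖z‖ ^ 2 := by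
  obtain ⟨C, hC0, hC⟩ := exists_norm_hat_rampWindow_le contDiff_smoothRamp
    (fun x hx ↦ smoothRamp_of_nonpos hx) (fun x hx ↦ smoothRamp_of_one_le hx) hψ.contDiffOn_sqrt
  refine ⟨C, hC0, fun T hT z hz ↦ ?_⟩
  have h := hC (logHeight T) hT z hz
  have e : (fun u ↦ (phi ψ T u : ℂ)) = fun u ↦ ((smoothRamp (logHeight T / 2 + u) *
      smoothRamp (logHeight T / 2 - u) * Real.sqrt (ψ (clampHalf (u / logHeight T))) : ℝ) : ℂ) := by
    funext u; rfl
  rw [e]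
  exact h

/-- **Second-order decay of `Φ = (φ²)^`** ([AF26] §5.1 eq. (5.3): `max(|φ̂(r)|, |Φ(r)|) ≤ ϑ(r) =
min(L, 2/|r|, C_χ/(w r²))`, the `r⁻²` branch, here at complex argument): for a window `ψ` there is
`C` with `|Φ_T(z)| ≤ C e^{(L/2)|Im z|}/|z|²` for `L ≥ 1`, `z ≠ 0` (`φ² = χ²(L/2+u) χ²(L/2−u) ψ(u/L)` is
again ramp × ramp × `C²` core). [cite: AlpogeFurman2026, §5.1 eq. (5.3) (p. 7)] -/
theorem exists_norm_hat_phi_sq_le_inv_sq (hψ : IsWindow ψ) :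
    ∃ C : ℝ, 0 ≤ C ∧ ∀ T : ℝ, 1 ≤ logHeight T → ∀ z : ℂ, z ≠ 0 →
      ‖hat (fun u ↦ ((phi ψ T u ^ 2 : ℝ) : ℂ)) z‖ ≤ C * Real.exp (logHeight T / 2 * |z.im|) / ‖z‖ ^ 2 := by
  obtain ⟨hr, hr0, hr1⟩ := smoothRamp_sq_ramp
  obtain ⟨C, hC0, hC⟩ := exists_norm_hat_rampWindow_le hr hr0 hr1 hψ.contDiffOn
  refine ⟨C, hC0, fun T hT z hz ↦ ?_⟩
  have h := hC (logHeight T) hT z hz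
  have e : (fun u ↦ ((phi ψ T u ^ 2 : ℝ) : ℂ)) = fun u ↦ ((smoothRamp (logHeight T / 2 + u) ^ 2 *
      smoothRamp (logHeight T / 2 - u) ^ 2 * ψ (clampHalf (u / logHeight T)) : ℝ) : ℂ) := by
    funext u
    have hsq : Real.sqrt (ψ (clampHalf (u / logHeight T))) ^ 2 = ψ (clampHalf (u / logHeight T)) :=
      Real.sq_sqrt (hψ.pos _ (clampHalf_mem _)).le
    simp only [phi]
    rw [mul_pow, mul_pow, hsq]
  rw [e]
  exact h

/-- Real-argument form for `Φ`: `|Φ_T(x)| ≤ C/x²` (`x ≠ 0`, `L ≥ 1`). [cite: AlpogeFurman2026, §5.1 eq. (5.3) (p. 7)] -/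
theorem exists_norm_hat_phi_sq_ofReal_le (hψ : IsWindow ψ) :
    ∃ C : ℝ, 0 ≤ C ∧ ∀ T : ℝ, 1 ≤ logHeight T → ∀ x : ℝ, x ≠ 0 →
      ‖hat (fun u ↦ ((phi ψ T u ^ 2 : ℝ) : ℂ)) x‖ ≤ C / x ^ 2 := by
  obtain ⟨C, hC0, hC⟩ := exists_norm_hat_phi_sq_le_inv_sq hψ
  refine ⟨C, hC0, fun T hT x hx ↦ ?_⟩
  have h := hC T hT (x : ℂ) (Complex.ofReal_ne_zero.2 hx)
  simp only [Complex.ofReal_im, abs_zero, mul_zero, Real.exp_zero, mul_one, Complex.norm_real,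
    Real.norm_eq_abs, sq_abs] at h
  exact h

/-- Real-argument form for `φ̂` off the real axis by `|y| ≤ ½`: `|φ̂_T(ξ + iy)| ≤ C e^{L|y|/2}/(ξ² + y²)`.
[cite: AlpogeFurman2026, §2.2 eq. (2.8) (p. 4)] -/
theorem exists_norm_hat_phi_le_inv_sq' (hψ : IsWindow ψ) :
    ∃ C : ℝ, 0 ≤ C ∧ ∀ T : ℝ, 1 ≤ logHeight T → ∀ (ξ y : ℝ), (ξ ≠ 0 ∨ y ≠ 0) →
      ‖hat (fun u ↦ (phi ψ T u : ℂ)) ((ξ : ℂ) + (y : ℂ) * I)‖ ≤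
        C * Real.exp (logHeight T * |y| / 2) / (ξ ^ 2 + y ^ 2) := by
  obtain ⟨C, hC0, hC⟩ := exists_norm_hat_phi_le_inv_sq hψ
  refine ⟨C, hC0, fun T hT ξ y hne ↦ ?_⟩
  have hz : ((ξ : ℂ) + (y : ℂ) * I) ≠ 0 := by
    intro h
    have h1 := congrArg Complex.re h
    have h2 := congrArg Complex.im h
    simp at h1 h2
    rcases hne with hne | hne
    · exact hne h1
    · exact hne h2
  have h := hC T hT _ hz
  have him : ((ξ : ℂ) + (y : ℂ) * I).im = y := by simp
  have hnorm : ‖(ξ : ℂ) + (y : ℂ) * I‖ ^ 2 = ξ ^ 2 + y ^ 2 := by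
    rw [Complex.sq_norm, Complex.normSq_apply]
    simp; ring
  rw [him, hnorm, show logHeight T / 2 * |y| = logHeight T * |y| / 2 by ring] at h
  exact h

end Window

end AlpogeFurman2026

end Literature.NumberTheory.LFunctions

end
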